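import Literature.MathematicalPhysics.QuantumFieldTheory.Balaban1983to89.B8Prop5UniqSectE
import Literature.MathematicalPhysics.QuantumFieldTheory.Balaban1983to89.B8Prop5UniqKLevelB

/-!
# `Balaban1983to89.B8Prop5UniqSectEW` — [Balaban1985RegularSpaces] Proposition 5, THE UNIQUENESS CLAUSE (1.109) p. 94 at `k` levels with
# Sect. E instantiated, AT PRINT'S GENERALITY: `pub-ymgap-dag-n04-b`'s `B8Prop5UniqSectE.hFP_unique_of_sectE_local` with Theorem 4's datum
# (`U₁^{u₁}U₀` axial) REPLACED by print's hypothesis on `u₁` — (1.73)/(1.74) + (1.68) ⇒ «u₁ ∈ Λ_j(U₀, α₃) on Bʲ(Λ_j)» (p. 89), typed as unitary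
# Λ_j-witnesses — and with [4]'s left-inverse law of `G′` asked on bounded functions only (W8″ guard, `B8Prop5UniqKLevelB`)

statement-level skeleton of published theorems with citation tags; proofs where landed; nothing here is a claim about the
Yang–Mills mass gap

PDF held: `paper:balaban1985-cmp99-regular-spaces-gauge-fixing` (journal page = PDF page + 74); p. 89 (after (1.76)), pp. 92–97, Prop. 5 p. 94.
[3] = [Balaban1985Averaging] (Prop. 10 p. 50, (166)–(167) p. 44); [4] = [Balaban1985BackgroundPropagators] (Thm 3.1 p. 397, (3.25) p. 394).

WHY THIS FILE (cell `pub-ymgap`, HUMAN RULING D-0062; R134 acceleration seat `pub-ymgap-dag-n05-d` (g3) — the UNIQUENESS twin of the LOCATED row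
(L1) «Proposition 5 AS PRINTED at the member of record `zdLan`»; the existence twin is seat `pub-ymgap-dag-n05-c` g3's `B8Prop5JoinSectELocalRDW`).
The tree's uniqueness JOIN consumes Theorem 4's datum — `hAx : U₁^{u₁}U₀ ∈ Ax_k(𝔅_k, U₀)` — at exactly three points (`B8Prop5JoinSectE.sectE_exists`,
`sectE_lipschitz`, and `witness_unitary_of_glev ∘ glev_on_towers_of_axial`), each time only to manufacture a Λ_j-WITNESS for `u₁` («a global unitary
`ũ ∈ Λ_j(π^*U₀, α₃)` agreeing with `u₁` on `Bʲ(y)`», `B8SectEInLambdaWitness`).  Print's Proposition 5 takes an ARBITRARY `u₁` with (1.68), (1.73),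
(1.74) and uses exactly «u₁ satisfies (166), (167) [3] on Bʲ(Λ_j)» (p. 89) — i.e. the witness.  THIS FILE re-runs the uniqueness JOIN with the
witness as the hypothesis (n04-b's witness-form cores `exists_Dprime_kLevel_w`, `Dprime_lipschitz_kLevel_w`, `witness_inv_of_unitary`,
`cond179_gaugeExp_of_restr129_local` BY NAME), over the guarded engine `B8Prop5UniqKLevelB.hFP_unique_of_cond179_bdd`:
**`hFP_unique_of_sectE_local_wb`**.  Consumer: `B8Prop5UniqueZdLan` — `B8.Prop5Unique (zdLan L B₁ ∘ cut)` at lit-balaban's member of record, whose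
`Hyp169` supplies the witnesses (`B8Prop5WitnessOfDatum.hwit_of_hyp169`, seat `pub-ymgap-dag-n05-c`).

HONEST SCOPE.  Assembly over landed modules with two binders re-typed (datum ↦ witness, total ↦ bounded left inverse); nothing of [4], of Sect. E
or of the contraction is proved here beyond composition; constants are the lineage's, sufficient only.  Count-neutral; N05 NOT discharged; one
finite T⁴ programme at fixed ε; nothing continuum / ℝ⁴ / OS / mass-gap / Clay.  Unit `pub-ymgap-dag-n05-d` (g3), 2026-08-27.  Tree API by name
only, nothing restated (the private `norm_negI_smul` is a file-local copy of `B8Prop5UniqSectE`'s).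
-/

noncomputable section

open NormedSpace Metric Set Filter Topology
open Complex (I)

namespace Literature.MathematicalPhysics.QuantumFieldTheory.Balaban1983to89.B8Prop5UniqSectEW

open B7Prop1Explicit (e U1 expUnit val_inv_expUnit val_expUnit)
open B7Prop2Explicit (unitaryUnits mem_unitaryUnits unitaryUnits_le_U1 avgClosed_unitaryUnits AvgClosed C0 c2')
open B7Prop1Local (InBox pdevOn clampCfg)
open B7Prop3Flat (expCfg c3)
open B7Eq78Linearization (conjR zdBlocking QprimeIter QprimeIter_smul)
open B7Eq167Flat (InLambda)
open B7Eq170Flat (cj cj_apply)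
open B7Prop10General (C6 C4G utilG)
open B7Prop10Flat (one_le_C5 C4'_nonneg C5'_nonneg)
open B7Prop9Flat (C5')
open B7Eq214General (Cgen)
open B8Ineq130 (tlo thi tlo_zero thi_zero)
open B7Eq84Concrete (uavg)
open B7Eq92Concrete (mgauge)
open B8Eq119TwistedAxial (bgT InAx Restr129)
open B8Eq178Averages (util178 Qnl Cond179 restr129_iff_uavg utilG_eq_uavg_mul_inv util178_eq_utilG)
open B8Eq1123Concrete (Cnl cj_smul_complex)
open B8Ineq125Concrete (C2p C2p_nonneg)
open B8Eq1117Concrete (XSpace)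
open B8DprimeKLevelLipschitz (smallness_prod)
open B8SectEInLambdaWitness (witness_inv_of_unitary)
open B8SectEKLevelInLambda (exists_Dprime_kLevel_w Dprime_lipschitz_kLevel_w)
open B8Ineq132 (covDerivFwd covDeriv norm_conjR)
open B8Eq151V2Divergence (covDerivFwd_smul)
open B8Eq138LandauZd (covLap covDivB QT)
open B8Eq182Proof (gAd)
open B8Eq184Proof (gaugeExp)
open B8Eq188Proof (frakF3)
open B8LambdaSpaceKLevel (wt wt_pos wt_nonneg lamSubK lamOf lamOf_sub norm_lamOf_le weight_mul_norm_covDerivFwd_le norm_cjDiff_lamOf_le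
  norm_le_iff norm_sub_le_iff covDerivFwd_sub')
open B8Prop5ContractionKLevel (Bd2 Mc Kc)
open B8Prop5KLevelLetters (covLap_sub)
open B8Prop5JoinSectE (ball_sub_119 ball_diff_modulus hH1_tower cjDiff_le_of_weighted covLap_smul)
open B8Prop5GaugeParamKLevel (gpar_size)
open B8Prop5UniqSectE (cond179_gaugeExp_of_restr129_local)
open B8Prop5UniqKLevelB (hFP_unique_of_cond179_bdd)

-- `Site` alone could resolve to the torus sites of `Setup.lean`; re-export the `ℤ^d` sites of `B7Prop1Explicit`.
export B7Prop1Explicit (Site)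

variable {d : ℕ} {𝔸 : Type*} [CStarAlgebra 𝔸] [Nontrivial 𝔸]

/-! ## Proposition 5's uniqueness (1.109) at `k` levels, Sect. E instantiated, witness form, guarded left inverse -/

section SectEW

variable {L k : ℕ} {η : ℝ} {Ω Λs : ℕ → Set (Site d)} {Eb : ℕ → Set (Site d × Fin d)} {U₀ : Site d → Fin d → 𝔸ˣ}
  {A : Site d → Fin d → 𝔸} {u₁ : Site d → 𝔸ˣ}

omit [Nontrivial 𝔸] in
/-- `‖(−i)·a‖ = ‖a‖`. [folklore] -/
private theorem norm_negI_smul (a : 𝔸) : ‖(-I) • a‖ = ‖a‖ := by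
  rw [norm_smul, norm_neg, Complex.norm_I, one_mul]

/-- **PROPOSITION 5, THE UNIQUENESS CLAUSE (1.109), AT `k` LEVELS ON THE `Ω 0 = univ` SUB-FAMILY — SECT. E INSTANTIATED, AT PRINT'S
GENERALITY (Λ_j-WITNESSES FOR `u₁`) AND WITH [4]'S LEFT-INVERSE LAW ON BOUNDED FUNCTIONS.**  `B8Prop5UniqSectE.hFP_unique_of_sectE_local` (seat
`pub-ymgap-dag-n04-b` g5) VERBATIM except: (i) the Theorem-4 datum binders (`B`, `cB`, `αP`, `hBu`, (1.69) `h69`, the full field's regularity `hP`,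
(1.34) `hAx`, the glev windows `hsmall hc₃ hsc`) are REPLACED by the hypothesis print's Proposition 5 actually makes on `u₁` — p. 89: «(1.73), (1.74)
together with the condition R₀ū₁ʲ = 1 on Λ_j imply that u₁ satisfies (166), (167) [3] on Bʲ(Λ_j) … with α₃ = 16dB₁(α₀+α₁)» — typed as a UNITARY
Λ_j-WITNESS at every `(j, y ∈ Λ_j)` (`hwit`, the binder of n04-b's `B8Restr129InversionLocal.restr129_mul_inv_of_cond179_local`; supplied from
print's datum by `B8Prop5WitnessOfDatum.hwit_unitary_of_datum`, seat `pub-ymgap-dag-n05-c`), with a free class constant `α₃` in every window where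
`40·d·c_B` stood, and (1.29) `h129` kept ((1.68), p. 90); Sect. E's `D′` for the inverse pair is taken from n04-b's witness-form cores
`B8SectEKLevelInLambda.exists_Dprime_kLevel_w` / `Dprime_lipschitz_kLevel_w` at the inverse witness `ũ⁻¹` (`B8SectEInLambdaWitness.witness_inv_of_unitary`,
(1.112) p. 95); (ii) the TOTAL left-inverse law `g_left` of `G′` is re-typed `g_leftB` (bounded inputs only, [Balaban1985BackgroundPropagators] Thm 3.1
p. 397; engine `B8Prop5UniqKLevelB.hFP_unique_of_cond179_bdd`).  DISPLAYED otherwise as there: the letters `g Δ q qs Aw c` with `c_left'`, `hΔ`,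
`hqs`, `hq`, `hq0`; `H′` with (1.92) `hH0 hH1 hH2` and (1.91) `hQH`; (1.101) `hG`, (1.98)R `hRbd`; (1.33) on the towers `h33`; tower bonds in `Eb j`;
the source `D*A` (`hDA`, `hA`); JOIN-C's windows at `α₃` PLUS the two uniqueness windows `hlE : lE ≤ ½`, `hρ : ρ + hE ≤ ¼α₄`.  CLAIM: two site
functions `λ′₁, λ′₂` with `‖λ′ᵢ‖ ≤ ρ` everywhere and `(Lʲη)‖D^η_{U₀}λ′ᵢ‖ ≤ ρ` on the `Eb j`, each obeying `HFP`'s multiplier clause and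
`Restr129 L k Λs U₀ (u₁·e^{iλ′ᵢ})`, ARE EQUAL.
[cite: Balaban1985RegularSpaces, Prop. 5 (1.109) p.94, p.89 (after (1.76)), (1.112)–(1.121) pp.95–97, (1.92) p.91, (1.95)–(1.106) pp.92–94, (1.78)–(1.79) p.90,
(1.29) p.81; Balaban1985Averaging, Prop. 10 p.50, (166)–(167) p.44, (178) p.45; Balaban1985BackgroundPropagators, Thm 3.1 p.397] -/
theorem hFP_unique_of_sectE_local_wb (hL : 2 ≤ L) (hη : 0 < η) (hU₀ : ∀ x κ, U₀ x κ ∈ unitaryUnits 𝔸) (hΩ0 : Ω 0 = Set.univ)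
    (hEbΩ : ∀ j, j ≤ k → ∀ x ∈ Ω j, ∀ μ : Fin d, (x, μ) ∈ Eb j ∧ (x - e μ, μ) ∈ Eb j)
    (hEbT : ∀ j, j ≤ k → ∀ y ∈ Λs j, ∀ (x : Site d) (κ : Fin d), InBox (tlo L y j) (thi L y j) x →
      InBox (tlo L y j) (thi L y j) (x + e κ) → (x, κ) ∈ Eb j)
    -- letters of [4]
    (g Δ : (Site d → 𝔸) →ₗ[ℂ] (Site d → 𝔸)) (q : (Site d → 𝔸) →ₗ[ℂ] (ℕ → Site d → 𝔸)) (qs : (ℕ → Site d → 𝔸) →ₗ[ℂ] (Site d → 𝔸))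
    (Aw c : (ℕ → Site d → 𝔸) →ₗ[ℂ] (ℕ → Site d → 𝔸))
    (g_leftB : ∀ x : Site d → 𝔸, (∃ C : ℝ, ∀ y, ‖x y‖ ≤ C) → g (Δ x + qs (Aw (q x))) = x)
    (c_left' : ∀ φ, qs (c (q (g (g (qs φ))))) = qs φ)
    (hΔ : ∀ (f : Site d → 𝔸), ∀ x ∈ Ω 0, Δ f x = covLap η U₀ ((Ω 0).indicator f) x)
    (hqs : ∀ (μ : ℕ → Site d → 𝔸), ∀ x ∈ Ω 0, qs μ x = QT L k Λs U₀ μ x)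
    (hq : ∀ (f : Site d → 𝔸) (j : ℕ), j ≤ k → ∀ y ∈ Λs j, q f j y = QprimeIter (zdBlocking d L) (bgT L U₀) j f y)
    (hq0 : ∀ (f : Site d → 𝔸) (j : ℕ) (y : Site d), ¬ (j ≤ k ∧ y ∈ Λs j) → q f j y = 0)
    -- the letter H′ of [4] ((1.91)–(1.92)) and the Sect. E / local-inversion regime (tower-local, everything AT u₁)
    (H' : XSpace d k 𝔸 →ₗ[ℂ] (Site d → 𝔸)) {α₀ α₃ α₄ B₀' B₂' : ℝ}
    (hα : 0 < α₀) (hα3 : C0 d * α₀ ≤ 1 / 3) (hα4 : 4 * α₀ ≤ c2' d L) (hα₃ : 0 ≤ α₃) (hα₄ : 0 < α₄) (hB : 0 < B₀') (hB₂ : 0 ≤ B₂')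
    (h33 : ∀ j, j ≤ k → ∀ y ∈ Λs j, pdevOn (tlo L y j) (thi L y j) U₀ < α₀ * (((L : ℝ) ^ j)⁻¹) ^ 2)
    -- print's tower regime of `u₁` ((1.73)/(1.74) ⇒ (166)/(167) on Bʲ(Λ_j), p. 89) as UNITARY Λ_j-WITNESSES, and (1.68) ⇒ (1.29)
    (hwit : ∀ j, j ≤ k → ∀ y ∈ Λs j, ∃ ut : Site d → 𝔸ˣ, (∀ x, ut x ∈ unitaryUnits 𝔸) ∧
      InLambda L (clampCfg (tlo L y j) (thi L y j) U₀) ut j α₃ (((L : ℝ) ^ j)⁻¹) ∧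
      ∀ x : Site d, tlo L y j ≤ x → x ≤ thi L y j → u₁ x = ut x)
    (h129 : Restr129 L k Λs U₀ u₁)
    (hH0 : ∀ (X : XSpace d k 𝔸) (x : Site d), ‖H' X x‖ ≤ B₀' * ‖X‖)
    (hH1 : ∀ j, j ≤ k → ∀ (X : XSpace d k 𝔸), ∀ p ∈ Eb j, wt L η j * ‖covDerivFwd η U₀ p.2 (H' X) p.1‖ ≤ B₀' * ‖X‖)
    (hH2 : ∀ X : XSpace d k 𝔸, Bd2 L η k Ω (covLap η U₀ (H' X)) (B₂' * ‖X‖))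
    (hQH : ∀ (Y : XSpace d k 𝔸) (j : ℕ) (hj : j ≤ k) (y : Site d), y ∈ Λs j →
      QprimeIter (zdBlocking d L) (bgT L U₀) j (H' Y) y = Y (⟨j, Nat.lt_succ_of_le hj⟩, y))
    (hα₃' : α₃ ≤ 1 / 200)
    (hs₁ : 200 * C6 d * (2 * α₄) ≤ 1) (hs₂ : 12000 * ((d : ℝ) + 1) * L * (2 * α₄) ≤ 1)
    (hs₃ : C4G d L * (α₀ + α₃ + 4 * (2 * α₄)) ≤ 1)
    (hs₄ : 1024 * ((d : ℝ) + 1) * ((d : ℝ) + 4) * L ^ 2 * α₀ ≤ 1) (hs₅ : 32 * ((d : ℝ) + 1) ^ 2 * C6 d * L ^ 2 * α₀ ≤ 1)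
    (hs₆ : 16 * d * C5' d * C6 d * (L : ℝ) ^ 2 * α₀ ≤ 1) (hs₇ : 8 * d * C6 d * L * α₀ ≤ 1)
    (hsm : α₃ + α₄ ≤ 1 / (4 * B₀' * (2 * C2p d))) (hprod8 : 2 * C6 d * (α₃ + 4 * α₄) ≤ 1 / 8)
    -- the Sect. E sizes of H_c (named, so that the windows below read)
    {hE hE₂ lE lE₂ : ℝ} (hE_def : hE = B₀' * (C2p d * (α₃ + α₄) * α₄)) (hE₂_def : hE₂ = B₂' * (C2p d * (α₃ + α₄) * α₄))
    (lE_def : lE = B₀' * (4 * C2p d * (α₃ + 2 * α₄))) (lE₂_def : lE₂ = B₂' * (4 * C2p d * (α₃ + 2 * α₄)))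
    -- JOIN-B's letters G′, R, the datum, and its windows at these sizes; the two uniqueness windows
    {BG BR cA cDA ρ : ℝ} (hBG : 0 ≤ BG) (hBR : 0 ≤ BR) (hcA : 0 ≤ cA) (hcA' : cA ≤ 1 / 13) (hcDA : 0 ≤ cDA)
    (ha₁' : α₄ / 4 + hE ≤ 1 / 24) (hb₁' : α₄ / 4 + hE ≤ 1 / 140) (hθ : 10 * (α₄ / 4 + hE) * BR ≤ 1 / 2)
    (hlE : lE ≤ 1 / 2) (hρ : ρ + hE ≤ α₄ / 4)
    (hG : ∀ (f : Site d → 𝔸) (m : ℝ), 0 ≤ m → Bd2 L η k Ω f m →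
      (∀ x, ‖g f x‖ ≤ BG * m) ∧ ∀ j, j ≤ k → ∀ p ∈ Eb j, wt L η j * ‖covDerivFwd η U₀ p.2 (g f) p.1‖ ≤ BG * m)
    (hRbd : ∀ (f : Site d → 𝔸) (m : ℝ), 0 ≤ m → Bd2 L η k Ω f m → Bd2 L η k Ω (f - g (qs (c (q (g f))))) (BR * m))
    (hDA : Bd2 L η k Ω (fun y => covDivB η U₀ A y) cDA)
    (hA : ∀ j, j ≤ k → ∀ x ∈ Ω j, ∀ μ : Fin d,
      wt L η j * ‖A x μ‖ ≤ cA ∧ wt L η j * ‖conjR (U₀ (x - e μ) μ)⁻¹ (A (x - e μ) μ)‖ ≤ cA)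
    (h103 : BG * Mc d BR (α₄ / 4 + hE) cA hE₂ cDA ≤ α₄ / 4)
    (h106 : BG * Kc d BR (α₄ / 4 + hE) cA hE₂ cDA lE₂ (1 + lE) (1 + lE) ≤ 1 / 2)
    -- the two solutions
    {lam₁ lam₂ : Site d → 𝔸}
    (hl₁ : ∀ x, ‖lam₁ x‖ ≤ ρ) (hD₁ : ∀ j, j ≤ k → ∀ p ∈ Eb j, wt L η j * ‖covDerivFwd η U₀ p.2 lam₁ p.1‖ ≤ ρ)
    (hmult₁ : ∃ μ : ℕ → Site d → 𝔸, ∀ x ∈ Ω 0,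
      covLap η U₀ ((Ω 0).indicator fun y => covDivB η U₀ A y + covLap η U₀ lam₁ y +
        ((conjR (gaugeExp lam₁ y)⁻¹ (covDivB η U₀ A y) - covDivB η U₀ A y) +
          (gAd (covLap η U₀ lam₁ y) (lam₁ y) - covLap η U₀ lam₁ y) + ∑ μ, frakF3 η U₀ lam₁ A y μ)) x = QT L k Λs U₀ μ x)
    (h129₁ : Restr129 L k Λs U₀ (u₁ * gaugeExp lam₁))
    (hl₂ : ∀ x, ‖lam₂ x‖ ≤ ρ) (hD₂ : ∀ j, j ≤ k → ∀ p ∈ Eb j, wt L η j * ‖covDerivFwd η U₀ p.2 lam₂ p.1‖ ≤ ρ)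
    (hmult₂ : ∃ μ : ℕ → Site d → 𝔸, ∀ x ∈ Ω 0,
      covLap η U₀ ((Ω 0).indicator fun y => covDivB η U₀ A y + covLap η U₀ lam₂ y +
        ((conjR (gaugeExp lam₂ y)⁻¹ (covDivB η U₀ A y) - covDivB η U₀ A y) +
          (gAd (covLap η U₀ lam₂ y) (lam₂ y) - covLap η U₀ lam₂ y) + ∑ μ, frakF3 η U₀ lam₂ A y μ)) x = QT L k Λs U₀ μ x)
    (h129₂ : Restr129 L k Λs U₀ (u₁ * gaugeExp lam₂)) :
    lam₁ = lam₂ := by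
  have hL1 : 1 ≤ L := le_trans (by norm_num) hL
  have hC2 : 0 ≤ C2p d := C2p_nonneg d
  have hhE : 0 ≤ hE := by rw [hE_def]; positivity
  have hhE₂ : 0 ≤ hE₂ := by rw [hE₂_def]; positivity
  have hlE0 : 0 ≤ lE := by rw [lE_def]; positivity
  have hlE₂ : 0 ≤ lE₂ := by rw [lE₂_def]; positivity
  have hb₁ : 0 < α₄ / 4 + hE := add_pos_of_pos_of_nonneg (by positivity) hhE
  have hρ0 : 0 ≤ ρ := (norm_nonneg _).trans (hl₁ 0)
  have hα2 : 2 * α₀ ≤ c2' d L := by linarith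
  -- Λ_j-witnesses for the INVERSE `u₁⁻¹` (Sect. E runs on the inverse pair): `ũ⁻¹`, by the inverse-closure of `Λ_j` for unitary data ((1.112) p. 95)
  have hwiti : ∀ j, j ≤ k → ∀ y ∈ Λs j, ∃ ut : Site d → 𝔸ˣ,
      InLambda L (clampCfg (tlo L y j) (thi L y j) U₀) ut j α₃ (((L : ℝ) ^ j)⁻¹) ∧
      ∀ x : Site d, tlo L y j ≤ x → x ≤ thi L y j → u₁⁻¹ x = ut x := by
    intro j hj y hy
    obtain ⟨ut, hun, hW, hag⟩ := hwit j hj y hy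
    exact witness_inv_of_unitary hL hU₀ hα hα3 hα2 (h33 j hj y hy) hL1 hα₃ (by linarith) hun hW hag
  -- THE solution map D′(u₁⁻¹, −i·) on the ¼α₄-ball, chosen once (reality not needed)
  have key : ∀ lam : Site d → 𝔸, ∃ X : XSpace d k 𝔸, ∀ s : lamSubK η U₀ L k Eb, lamOf s = lam → ‖s‖ ≤ α₄ / 4 →
      ‖X‖ ≤ α₄ / (2 * B₀') ∧ ‖X‖ ≤ C2p d * (α₃ + α₄) * α₄ ∧
      (∀ (j : ℕ) (hj : j ≤ k) (y : Site d), y ∉ Λs j → X (⟨j, Nat.lt_succ_of_le hj⟩, y) = 0) ∧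
      (∀ (j : ℕ) (hj : j ≤ k) (y : Site d), y ∈ Λs j →
        Cnl L U₀ u₁⁻¹ j ((-I) • lamOf s - H' X) y = X (⟨j, Nat.lt_succ_of_le hj⟩, y)) ∧
      ∀ (j : ℕ), j ≤ k → ∀ y ∈ Λs j,
        Qnl L U₀ (fun x => expUnit (((-I) • lamOf s - H' X) x)) u₁⁻¹ j y = QprimeIter (zdBlocking d L) (bgT L U₀) j ((-I) • lamOf s) y := by
    intro lam
    by_cases h : ∃ s : lamSubK η U₀ L k Eb, lamOf s = lam ∧ ‖s‖ ≤ α₄ / 4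
    · obtain ⟨s, rfl, hs⟩ := h
      obtain ⟨h119b, h119a⟩ := ball_sub_119 (Λs := Λs) hL1 hη hα₄ hEbT s hs
      obtain ⟨X, hX⟩ := exists_Dprime_kLevel_w (Λ := Λs) (lam := (-I) • lamOf s) (u₁ := u₁⁻¹) hL hL1 (avgClosed_unitaryUnits d L) hU₀ hα
        hα3 hα4 hα₃ hα₄ hB h33 hwiti h119b h119a hH0 (hH1_tower hL1 hη H' hEbT hH1) hQH hα₃' hs₁ hs₂ hs₃ hs₄ hs₅ hs₆ hs₇ hsm
      refine ⟨X, fun t ht _ => ?_⟩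
      rw [B8LambdaSpaceKLevel.ext_of_lamOf ht]
      exact hX
    · exact ⟨0, fun s h1 h2 => absurd ⟨s, h1, h2⟩ h⟩
  choose Dp hDp' using key
  have hDp := fun (s : lamSubK η U₀ L k Eb) (hs : ‖s‖ ≤ α₄ / 4) => hDp' (lamOf s) s rfl hs
  have hDpL : ∀ s t : lamSubK η U₀ L k Eb, ‖s‖ ≤ α₄ / 4 → ‖t‖ ≤ α₄ / 4 →
      ‖Dp (lamOf s) - Dp (lamOf t)‖ ≤ 4 * C2p d * (α₃ + 2 * α₄) * ‖s - t‖ := fun s t hs ht =>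
    by
    obtain ⟨h₁b, h₁a⟩ := ball_sub_119 (Λs := Λs) hL1 hη hα₄ hEbT s hs
    obtain ⟨h₂b, h₂a⟩ := ball_sub_119 (Λs := Λs) hL1 hη hα₄ hEbT t ht
    obtain ⟨hmb, hma⟩ := ball_diff_modulus (Λs := Λs) hL1 hη hEbT s t
    exact Dprime_lipschitz_kLevel_w (Λ := Λs) (lam₁ := (-I) • lamOf s) (lam₂ := (-I) • lamOf t) (u₁ := u₁⁻¹) hL hL1
      (avgClosed_unitaryUnits d L) hU₀ hα hα3 hα4 hα₃ hα₄ hB (norm_nonneg _) h33 hwiti h₁b h₁a h₂b h₂a hmb hma hH0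
      (hH1_tower hL1 hη H' hEbT hH1) hα₃' hs₁ hs₂ hs₃ hs₄ hs₅ hs₆ hs₇ hsm (hDp s hs).1 (hDp t ht).1 (hDp s hs).2.2.1 (hDp s hs).2.2.2.1
      (hDp t ht).2.2.1 (hDp t ht).2.2.2.1
  -- sizes of D′ and of its differences, multiplied by the (1.92) constants
  have hbdX : ∀ s : lamSubK η U₀ L k Eb, ‖s‖ ≤ α₄ / 4 → B₀' * ‖Dp (lamOf s)‖ ≤ hE := fun s hs => by
    rw [hE_def]; exact mul_le_mul_of_nonneg_left (hDp s hs).2.1 hB.le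
  have hbdX₂ : ∀ s : lamSubK η U₀ L k Eb, ‖s‖ ≤ α₄ / 4 → B₂' * ‖Dp (lamOf s)‖ ≤ hE₂ := fun s hs => by
    rw [hE₂_def]; exact mul_le_mul_of_nonneg_left (hDp s hs).2.1 hB₂
  have hbdL : ∀ s t : lamSubK η U₀ L k Eb, ‖s‖ ≤ α₄ / 4 → ‖t‖ ≤ α₄ / 4 → B₀' * ‖Dp (lamOf s) - Dp (lamOf t)‖ ≤ lE * ‖s - t‖ :=
    fun s t hs ht => by
    rw [lE_def, mul_assoc]; exact mul_le_mul_of_nonneg_left (hDpL s t hs ht) hB.le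
  have hbdL₂ : ∀ s t : lamSubK η U₀ L k Eb, ‖s‖ ≤ α₄ / 4 → ‖t‖ ≤ α₄ / 4 → B₂' * ‖Dp (lamOf s) - Dp (lamOf t)‖ ≤ lE₂ * ‖s - t‖ :=
    fun s t hs ht => by
    rw [lE₂_def, mul_assoc]; exact mul_le_mul_of_nonneg_left (hDpL s t hs ht) hB₂
  have hsubH : ∀ s t : lamSubK η U₀ L k Eb, (-I) • H' (Dp (lamOf s)) - (-I) • H' (Dp (lamOf t)) = (-I) • H' (Dp (lamOf s) - Dp (lamOf t)) :=
    fun s t => by rw [map_sub, smul_sub]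
  -- the six binders of the engine for `H_c λ := −i·H′D′(u₁⁻¹, −iλ)`
  have hc0 : ∀ s : lamSubK η U₀ L k Eb, ‖s‖ ≤ α₄ / 4 → ∀ x, ‖((-I) • H' (Dp (lamOf s))) x‖ ≤ hE := fun s hs x => by
    rw [Pi.smul_apply, norm_negI_smul]; exact (hH0 _ x).trans (hbdX s hs)
  have hc1 : ∀ s : lamSubK η U₀ L k Eb, ‖s‖ ≤ α₄ / 4 → ∀ j, j ≤ k → ∀ p ∈ Eb j,
      wt L η j * ‖covDerivFwd η U₀ p.2 ((-I) • H' (Dp (lamOf s))) p.1‖ ≤ hE := fun s hs j hj p hp => by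
    rw [covDerivFwd_smul, norm_negI_smul]; exact (hH1 j hj _ p hp).trans (hbdX s hs)
  have hc2 : ∀ s : lamSubK η U₀ L k Eb, ‖s‖ ≤ α₄ / 4 → Bd2 L η k Ω (covLap η U₀ ((-I) • H' (Dp (lamOf s)))) hE₂ :=
    fun s hs j hj x hx => by
    rw [covLap_smul, norm_negI_smul]; exact (hH2 _ j hj x hx).trans (hbdX₂ s hs)
  have hcL0 : ∀ s t : lamSubK η U₀ L k Eb, ‖s‖ ≤ α₄ / 4 → ‖t‖ ≤ α₄ / 4 → ∀ x,
      ‖((-I) • H' (Dp (lamOf s))) x - ((-I) • H' (Dp (lamOf t))) x‖ ≤ lE * ‖s - t‖ := fun s t hs ht x => by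
    rw [← Pi.sub_apply, hsubH, Pi.smul_apply, norm_negI_smul]; exact (hH0 _ x).trans (hbdL s t hs ht)
  have hcL1 : ∀ s t : lamSubK η U₀ L k Eb, ‖s‖ ≤ α₄ / 4 → ‖t‖ ≤ α₄ / 4 → ∀ j, j ≤ k → ∀ p ∈ Eb j,
      wt L η j * ‖covDerivFwd η U₀ p.2 ((-I) • H' (Dp (lamOf s)) - (-I) • H' (Dp (lamOf t))) p.1‖ ≤ lE * ‖s - t‖ :=
    fun s t hs ht j hj p hp => by
    rw [hsubH, covDerivFwd_smul, norm_negI_smul]; exact (hH1 j hj _ p hp).trans (hbdL s t hs ht)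
  have hcL2 : ∀ s t : lamSubK η U₀ L k Eb, ‖s‖ ≤ α₄ / 4 → ‖t‖ ≤ α₄ / 4 →
      Bd2 L η k Ω (covLap η U₀ ((-I) • H' (Dp (lamOf s))) - covLap η U₀ ((-I) • H' (Dp (lamOf t)))) (lE₂ * ‖s - t‖) :=
    fun s t hs ht j hj x hx => by
    rw [Pi.sub_apply, ← covLap_sub, hsubH, covLap_smul, norm_negI_smul]; exact (hH2 _ j hj x hx).trans (hbdL₂ s t hs ht)
  -- Sect. E's (1.114) in its CONVERSE printed use: (1.79) for the inverse pair ⇒ `Q′λ_s = 0` on `𝔅_k` ⇒ the vector `Q′λ_s` vanishes (`hq`, `hq0`)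
  have hIne : (-I : ℂ) ≠ 0 := neg_ne_zero.2 Complex.I_ne_zero
  have h114q : ∀ s : lamSubK η U₀ L k Eb, ‖s‖ ≤ α₄ / 4 →
      Cond179 L k Λs U₀ (gaugeExp (lamOf s + (fun lam => (-I) • H' (Dp lam)) (lamOf s)))⁻¹ u₁⁻¹ → q (lamOf s) = 0 := by
    intro s hs hC
    have hfun : (gaugeExp (lamOf s + (-I) • H' (Dp (lamOf s))))⁻¹ = fun x => expUnit (((-I) • lamOf s - H' (Dp (lamOf s))) x) := by
      funext x
      rw [Pi.inv_apply, gaugeExp, val_inv_expUnit]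
      congr 1
      rw [Pi.add_apply, Pi.smul_apply, smul_add, smul_smul, Pi.sub_apply, Pi.smul_apply, sub_eq_add_neg,
        show (I : ℂ) * (-I) = (1 : ℂ) by rw [mul_neg, Complex.I_mul_I, neg_neg], one_smul, neg_add, ← neg_smul]
    funext j y
    by_cases hjy : j ≤ k ∧ y ∈ Λs j
    · have h1 : Qnl L U₀ (fun x => expUnit (((-I) • lamOf s - H' (Dp (lamOf s))) x)) u₁⁻¹ j y = 0 := by
        have h := hC j hjy.1 y hjy.2
        rwa [show (fun lam => (-I) • H' (Dp lam)) (lamOf s) = (-I) • H' (Dp (lamOf s)) from rfl, hfun] at h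
      rw [(hDp s hs).2.2.2.2 j hjy.1 y hjy.2] at h1
      have h2 := congrFun (QprimeIter_smul (zdBlocking d L) (bgT L U₀) (-I) (lamOf s) j) y
      rw [show ((-I) • lamOf s : Site d → 𝔸) = fun x => (-I) • lamOf s x from rfl, h2] at h1
      have h3 : QprimeIter (zdBlocking d L) (bgT L U₀) j (lamOf s) y = 0 := (smul_eq_zero.1 h1).resolve_left hIne
      rw [hq _ j hjy.1 y hjy.2, h3]
      rfl
    · rw [hq0 _ j y hjy]
      rfl
  -- r04's Prop-10 windows at 8α₄ and the local route's product window, from the Sect. E windows and `hprod8`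
  have hC6 : (0 : ℝ) ≤ C6 d := by
    have : (2 : ℝ) ≤ C6 d := by unfold C6; linarith only [one_le_C5 (d := d)]
    linarith only [this]
  have hw₁ : 10 * C6 d * (4 * (2 * α₄)) ≤ 1 := by nlinarith only [hs₁, hC6, hα₄.le]
  have hw₂ : 3000 * ((d : ℝ) + 1) * L * (4 * (2 * α₄)) ≤ 1 := by
    have e : 3000 * ((d : ℝ) + 1) * L * (4 * (2 * α₄)) = 12000 * ((d : ℝ) + 1) * L * (2 * α₄) := by ring
    rw [e]; exact hs₂
  have hprod : 2 * C6 d * (α₃ + 4 * (2 * α₄)) < 1 / 2 := by nlinarith only [hprod8, hC6, hα₃, hα₄.le]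
  -- (207) at 2α₄ for −iλ′ on the towers, from the ρ-ball (ρ < 2α₄); hence (1.79) for each competitor by §1
  have hρ2 : ρ < 2 * α₄ := by linarith
  have h179_of : ∀ lam' : Site d → 𝔸, (∀ x, ‖lam' x‖ ≤ ρ) → (∀ j, j ≤ k → ∀ p ∈ Eb j, wt L η j * ‖covDerivFwd η U₀ p.2 lam' p.1‖ ≤ ρ) →
      Restr129 L k Λs U₀ (u₁ * gaugeExp lam') → Cond179 L k Λs U₀ (gaugeExp lam')⁻¹ u₁⁻¹ := by
    intro lam' hl' hD' h129'
    have h177b : ∀ j, j ≤ k → ∀ y ∈ Λs j, ∀ x : Site d, InBox (tlo L y j) (thi L y j) x → ‖((-I) • lam') x‖ < 2 * α₄ := by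
      intro j _ y _ x _
      rw [Pi.smul_apply, norm_negI_smul]
      exact (hl' x).trans_lt hρ2
    have h177a : ∀ j, j ≤ k → ∀ y ∈ Λs j, ∀ (x : Site d) (κ : Fin d), InBox (tlo L y j) (thi L y j) x →
        InBox (tlo L y j) (thi L y j) (x + e κ) → ‖cj (U₀ x κ) (((-I) • lam') (x + e κ)) - ((-I) • lam') x‖ < 2 * α₄ * ((L : ℝ) ^ j)⁻¹ := by
      intro j hj y hy x κ hx hxe
      have hLj : (0 : ℝ) < ((L : ℝ) ^ j)⁻¹ := by
        have : (0 : ℝ) < L := by exact_mod_cast hL1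
        positivity
      have hb : (x, κ) ∈ Eb j := hEbT j hj y hy x κ hx hxe
      rw [Pi.smul_apply, Pi.smul_apply, cj_smul_complex, ← smul_sub, norm_negI_smul]
      calc ‖cj (U₀ x κ) (lam' (x + e κ)) - lam' x‖ ≤ ρ * ((L : ℝ) ^ j)⁻¹ := cjDiff_le_of_weighted hL1 hη (hD' j hj (x, κ) hb)
        _ < 2 * α₄ * ((L : ℝ) ^ j)⁻¹ := mul_lt_mul_of_pos_right hρ2 hLj
    exact cond179_gaugeExp_of_restr129_local hL hL1 hU₀ hα hα3 hα2 hα₃ (by linarith) (by positivity) h33 hwit h177b h177a hw₁ hw₂ hs₃ hs₄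
      hs₅ hs₆ hprod h129 h129'
  have h179₁ := h179_of lam₁ hl₁ hD₁ h129₁
  have h179₂ := h179_of lam₂ hl₂ hD₂ h129₂
  -- the engine
  exact hFP_unique_of_cond179_bdd hL1 hη hU₀ hΩ0 hEbΩ g Δ q qs Aw c g_leftB c_left' hΔ hqs (fun lam => (-I) • H' (Dp lam)) hα₄.le hBG hBR hhE
    hhE₂ hlE0 hlE0 hlE₂ hcA hcA' hcDA ha₁' hb₁' hb₁ hθ hlE hlE hρ hρ hG hRbd hc0 hc1 hc2 hcL0 hcL1 hcL2 hDA hA h103 h106 h114q hl₁ hD₁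
    hmult₁ h179₁ hl₂ hD₂ hmult₂ h179₂

end SectEW


#print axioms hFP_unique_of_sectE_local_wb

end Literature.MathematicalPhysics.QuantumFieldTheory.Balaban1983to89.B8Prop5UniqSectEW

end
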